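import Mathlib
import HarnessLib
import Summits.ValiantsHypothesis.ValiantsHypothesis.Theses.MonotoneRestoration
import Summits.ValiantsHypothesis.ValiantsHypothesis.Theorems.MonotoneRestorationOrbitRestorationLinearVolumeQPDiNarrowTight
import Summits.ValiantsHypothesis.ValiantsHypothesis.Theorems.MonotoneRestorationOrbitRestorationLinearVolumeQPSubThresholdDescent
import Summits.ValiantsHypothesis.ValiantsHypothesis.Theorems.MonotoneRestorationOrbitRestorationLinearVolumeQPDiUnfolding
import Summits.ValiantsHypothesis.ValiantsHypothesis.Theorems.MonotoneRestorationOrbitRestorationLinearVolumeQPNarrow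
import Summits.ValiantsHypothesis.ValiantsHypothesis.Theorems.MonotoneRestorationOrbitRestorationQPHomSpanNarrowFloor

/-!
# Route MonotoneRestoration — aside `OrbitRestorationLinearVolumeQP` (stmt-ValiantsHypothesis-18294):
# THE REGISTERED STUB IS TIGHT BELOW THE INJECTIVE THRESHOLD — R1 ⟹ `LvNarrowSpan` on half-degree levels

The registered skeleton of R1 (line `birth`, `0500973389fe`) rests on the single open stub
`stub_lvNarrowSpan : LvNarrowSpan` — every `VP` family of the linear-volume class lies, level by level, in the span
of the homomorphism polynomials of BIPARTITE patterns of treewidth `≤ (log₂ n + c)^c` — which is SUFFICIENT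
(`OrbitRestorationLinearVolumeQPNarrow.orbitRestorationLinearVolumeQP_of_lvNarrowSpan`) and VH-strength
(`…LvNarrowSpanVH`).  Whether it is NECESSARY was the descent question of the item's evidence memos.  Composing

* the crux in one-sorted EXPRESSION currency (`OrbitRestorationLinearVolumeQPDiNarrow.lvDiNarrow_of_…`, tight),
* the ONE-SORTED `k`-LABEL UNFOLDING (`DiUnfolding.close_mem_diNarrowSpan`: expression ⟹ one-sorted span of
  treewidth `≤ k - 1`, this hand), and
* SUB-THRESHOLD DESCENT (`SubThresholdDescent.subThreshold_descent`, p827466: for matrix-symmetric `p` with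
  `2 · deg p ≤ n`, one-sorted narrow span ⟹ bipartite narrow span, SAME width),

this file proves:

* `narrowSpan_halfDegree_of_diNarrow` — family by family, no `VP`: a matrix-symmetric family that is eventually
  the closed polynomial of one-sorted expressions with `n^k ≤ 2^{(log₂ n + c)^c}` labels lies, ON EVERY LEVEL WITH
  `2 · deg f_n ≤ n`, in the bipartite narrow span of width `(log₂ n + c')^{c'}` (small levels by the degree floor
  `HomSpan.mem_narrowSpan_of_degree_le`);
* `lvNarrowSpan_halfDegree_of_orbitRestorationLinearVolumeQP` — **R1 ⟹ the conclusion of the registered stub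
  `stub_lvNarrowSpan` on all half-degree levels** of every `VP ∩ LV` family;
* `orbitRestorationLinearVolumeQP_halfDegree_iff_lvNarrowSpan_halfDegree` — **on the sub-class of `VP ∩ LV`
  families with `2 · deg f_n ≤ n` for all `n`, R1's conclusion (square-symmetric circuits of quasi-polynomial
  orbit size) and the registered stub's conclusion (bipartite polylog-treewidth span) are EQUIVALENT**: below the
  injective threshold the line `birth` loses nothing.

Honest label (census for the planner): the gap between the registered stub and the crux is now PROVABLY confined
to the oversized regime `deg f_n > n/2` (descent above threshold with polylog loss: open, research-grade); the stub
itself (Dwivedi–Pago–Seppelt Outlook Q3 at qp scale), R1 and VP ≠ VNP are NOT moved.  Def-free helper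
(`--supports stmt-ValiantsHypothesis-18294`); nothing here is a named fact.

References: Dwivedi–Pago–Seppelt 2026 (arXiv:2601.09343) eq. (1), Outlook Q3; Dawar–Pago–Seppelt 2025
(arXiv:2502.06740) Thm 1.1, §5, §7 p. 45; Dawar–Wilsenach 2025 §6.
-/

noncomputable section

open scoped Classical

-- `Summit.ValiantsHypothesis.ValiantsHypothesis.…` is the tree's single-conjunct layout (Sub = Summit).
set_option linter.dupNamespace false

namespace Summit.ValiantsHypothesis.ValiantsHypothesis.Theorems.OrbitRestorationLinearVolumeQPHalfDegree

open Literature.Computability.AlgebraicComplexity MvPolynomial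
open Literature.Combinatorics.SimpleGraph (treewidth)
open Summit.ValiantsHypothesis.ValiantsHypothesis.Theorems
open Summit.ValiantsHypothesis.ValiantsHypothesis.Theorems.OrbitRestorationQPHomPolyClose

/-! ### One-sorted narrow expressions ⟹ bipartite narrow span on half-degree levels -/

/-- **One-sorted narrow expressions ⟹ bipartite narrow span below the injective threshold** (family by family,
no `VP`).  If a matrix-symmetric family `f` is, from some level on, the closed polynomial of a one-sorted labelled
pattern expression with `k` labels, `n^k ≤ 2^{(log₂ n + c)^c}`, then for one constant `c'` and EVERY level `n`
with `2 · deg f_n ≤ n`, `f n` lies in the span of the homomorphism polynomials of bipartite patterns of treewidth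
`≤ (log₂ n + c')^{c'}`.  (Levels `n ≥ max n₀ 2`: `k ≤ (log₂ n + c)^c`, unfold — `DiUnfolding.close_mem_diNarrowSpan`
— and descend — `SubThresholdDescent.subThreshold_descent`; small levels: the degree floor
`HomSpan.mem_narrowSpan_of_degree_le`, width `2 deg f_n ≤ n < c'`.) [folklore] -/
theorem narrowSpan_halfDegree_of_diNarrow (f : (n : ℕ) → MvPolynomial (Fin n × Fin n) ℂ)
    (hsymm : ∀ (n : ℕ) (σ τ : Equiv.Perm (Fin n)),
      rename (fun ij : Fin n × Fin n => (σ ij.1, τ ij.2)) (f n) = f n)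
    (h : ∃ c n₀ : ℕ, ∀ n : ℕ, n₀ ≤ n → ∃ (k : ℕ) (e : DiPatternExpr ℂ k),
      n ^ k ≤ 2 ^ ((Nat.log 2 n + c) ^ c) ∧ e.close n = f n) :
    ∃ c : ℕ, ∀ n : ℕ, 2 * (f n).totalDegree ≤ n → f n ∈ Submodule.span ℂ
      {p : MvPolynomial (Fin n × Fin n) ℂ | ∃ (a b : ℕ) (E : Multiset (Fin a × Fin b)),
        treewidth (SimpleGraph.fromRel fun u v : Fin a ⊕ Fin b =>
            ∃ e ∈ E, u = Sum.inl e.1 ∧ v = Sum.inr e.2) ≤ (Nat.log 2 n + c) ^ c ∧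
          p = homPoly E n ℂ} := by
  obtain ⟨c, n₀, hc⟩ := h
  refine ⟨c + max n₀ 2 + 1, fun n hdeg => ?_⟩
  -- monotonicity of the bipartite narrow span in the width
  have mono : ∀ w w' : ℕ, w ≤ w' →
      Submodule.span ℂ {p : MvPolynomial (Fin n × Fin n) ℂ | ∃ (a b : ℕ) (E : Multiset (Fin a × Fin b)),
        treewidth (SimpleGraph.fromRel fun u v : Fin a ⊕ Fin b =>
            ∃ e ∈ E, u = Sum.inl e.1 ∧ v = Sum.inr e.2) ≤ w ∧ p = homPoly E n ℂ} ≤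
      Submodule.span ℂ {p : MvPolynomial (Fin n × Fin n) ℂ | ∃ (a b : ℕ) (E : Multiset (Fin a × Fin b)),
        treewidth (SimpleGraph.fromRel fun u v : Fin a ⊕ Fin b =>
            ∃ e ∈ E, u = Sum.inl e.1 ∧ v = Sum.inr e.2) ≤ w' ∧ p = homPoly E n ℂ} := by
    intro w w' hww'
    refine Submodule.span_mono ?_
    rintro p ⟨a, b, E, hE, rfl⟩
    exact ⟨a, b, E, hE.trans hww', rfl⟩
  have hwidth : c + max n₀ 2 + 1 ≤ (Nat.log 2 n + (c + max n₀ 2 + 1)) ^ (c + max n₀ 2 + 1) :=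
    le_trans (Nat.le_add_left _ _) (Nat.le_self_pow (by omega) _)
  by_cases hn : max n₀ 2 ≤ n
  · -- large levels: unfold the one-sorted expression and descend
    obtain ⟨k, e, hk, he⟩ := hc n (le_trans (le_max_left _ _) hn)
    have hn2 : 2 ≤ n := le_trans (le_max_right _ _) hn
    have hkL : k ≤ (Nat.log 2 n + c) ^ c := by
      have h2 : 2 ^ k ≤ 2 ^ ((Nat.log 2 n + c) ^ c) := le_trans (Nat.pow_le_pow_left hn2 k) hk
      exact (Nat.pow_le_pow_iff_right Nat.one_lt_two).1 h2
    have hLL : (Nat.log 2 n + c) ^ c ≤ (Nat.log 2 n + (c + max n₀ 2 + 1)) ^ (c + max n₀ 2 + 1) :=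
      le_trans (Nat.pow_le_pow_left (by omega) c) (Nat.pow_le_pow_right (by omega) (by omega))
    have hmem := DiUnfolding.close_mem_diNarrowSpan k n
      ((Nat.log 2 n + (c + max n₀ 2 + 1)) ^ (c + max n₀ 2 + 1)) (by omega) e
    rw [he] at hmem
    exact SubThresholdDescent.subThreshold_descent n _ (f n) (hsymm n) hdeg hmem
  · -- small levels: the degree floor, width `2 · deg f_n ≤ n < max n₀ 2 ≤ c'`
    exact mono _ _ (le_trans (by omega) hwidth) (HomSpan.mem_narrowSpan_of_degree_le (f n) (hsymm n) le_rfl)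

/-! ### R1 ⟹ the registered stub's conclusion on half-degree levels -/

/-- **The linear-volume class is matrix-symmetric**: a combination of bipartite homomorphism polynomials is
invariant under independent row and column permutations (`rename_perm_homPoly`). [folklore] -/
theorem rename_perm_lvExpansion {n m : ℕ} (a b : Fin m → ℕ)
    (E : (i : Fin m) → Multiset (Fin (a i) × Fin (b i))) (α : Fin m → ℂ) (σ τ : Equiv.Perm (Fin n)) :
    rename (fun ij : Fin n × Fin n => (σ ij.1, τ ij.2)) (∑ i : Fin m, C (α i) * homPoly (E i) n ℂ) =
      ∑ i : Fin m, C (α i) * homPoly (E i) n ℂ := by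
  rw [map_sum]
  refine Finset.sum_congr rfl fun i _ => ?_
  rw [map_mul, rename_C, rename_perm_homPoly]

/-- **R1 ⟹ `LvNarrowSpan` ON HALF-DEGREE LEVELS.**  If `OrbitRestorationLinearVolumeQP` holds, then every `VP`
family of the linear-volume class lies, for one constant `c` and EVERY level `n` with `2 · deg f_n ≤ n`, in the
`ℂ`-span of the homomorphism polynomials of bipartite patterns of treewidth `≤ (log₂ n + c)^c` — verbatim the
conclusion of the registered stub `stub_lvNarrowSpan` of line `birth`, restricted to the half-degree levels.  So
the stub is NECESSARY for the crux below the injective threshold (it is sufficient everywhere,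
`OrbitRestorationLinearVolumeQPNarrow.orbitRestorationLinearVolumeQP_of_lvNarrowSpan`).
[cite: DwivediPagoSeppelt2026, Outlook Q3; DawarPagoSeppelt2025, Thm 1.1 and §7 p. 45] -/
theorem lvNarrowSpan_halfDegree_of_orbitRestorationLinearVolumeQP
    (h : Summit.ValiantsHypothesis.ValiantsHypothesis.Theses.MonotoneRestoration.OrbitRestorationLinearVolumeQP)
    (f : (n : ℕ) → MvPolynomial (Fin n × Fin n) ℂ) (hVP : IsVPFamily f)
    (hLV : ∃ (c : ℕ) (m : ℕ → ℕ) (a b : (n : ℕ) → Fin (m n) → ℕ)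
        (E : (n : ℕ) → (i : Fin (m n)) → Multiset (Fin (a n i) × Fin (b n i)))
        (α : (n : ℕ) → Fin (m n) → ℂ),
      (∀ n, m n ≤ (n + 2) ^ c) ∧ (∀ n i, a n i + b n i ≤ c * (n + 1)) ∧
        ∀ n, f n = ∑ i : Fin (m n), C (α n i) * homPoly (E n i) n ℂ) :
    ∃ c : ℕ, ∀ n : ℕ, 2 * (f n).totalDegree ≤ n → f n ∈ Submodule.span ℂ
      {p : MvPolynomial (Fin n × Fin n) ℂ | ∃ (a b : ℕ) (E : Multiset (Fin a × Fin b)),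
        treewidth (SimpleGraph.fromRel fun u v : Fin a ⊕ Fin b =>
            ∃ e ∈ E, u = Sum.inl e.1 ∧ v = Sum.inr e.2) ≤ (Nat.log 2 n + c) ^ c ∧
          p = homPoly E n ℂ} := by
  refine narrowSpan_halfDegree_of_diNarrow f (fun n σ τ => ?_)
    (OrbitRestorationLinearVolumeQPDiNarrow.lvDiNarrow_of_orbitRestorationLinearVolumeQP h f hVP hLV)
  obtain ⟨c, m, a, b, E, α, -, -, hf⟩ := hLV
  rw [hf n]
  exact rename_perm_lvExpansion (a n) (b n) (E n) (α n) σ τ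

/-! ### Below the threshold the registered stub is tight -/

/-- **BELOW THE INJECTIVE THRESHOLD, R1 AND ITS REGISTERED STUB COINCIDE.**  On the sub-class of `VP` families
of the linear-volume class ALL of whose levels satisfy `2 · deg f_n ≤ n`, the conclusion of the crux
`OrbitRestorationLinearVolumeQP` (square-symmetric circuits over `ℂ` of orbit size `≤ 2^{(log₂ n + c)^c}`) holds
for every such family if and only if the conclusion of the registered stub `stub_lvNarrowSpan` (membership of
every level in the span of the homomorphism polynomials of bipartite patterns of treewidth `≤ (log₂ n + c)^c`)
holds for every such family.  (`⟸`: K2 + K3, `narrowExpression_of_mem_narrowSpan` + `qpOrbit_of_close_eq`, as in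
`…LinearVolumeQPNarrow`; `⟹`: orbit support ⟹ one-sorted expressions (`OrbitSupport.qpOrbitFamily_iff_diNarrow`),
unfolding, sub-threshold descent.)  Every possible loss of line `birth` against the crux therefore lives in the
oversized regime `deg f_n > n/2`. [cite: DwivediPagoSeppelt2026, Outlook Q3; DawarPagoSeppelt2025, Thm 1.1 and §7 p. 45] -/
theorem orbitRestorationLinearVolumeQP_halfDegree_iff_lvNarrowSpan_halfDegree :
    (∀ f : (n : ℕ) → MvPolynomial (Fin n × Fin n) ℂ, IsVPFamily f →
      (∃ (c : ℕ) (m : ℕ → ℕ) (a b : (n : ℕ) → Fin (m n) → ℕ)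
          (E : (n : ℕ) → (i : Fin (m n)) → Multiset (Fin (a n i) × Fin (b n i)))
          (α : (n : ℕ) → Fin (m n) → ℂ),
        (∀ n, m n ≤ (n + 2) ^ c) ∧ (∀ n i, a n i + b n i ≤ c * (n + 1)) ∧
          ∀ n, f n = ∑ i : Fin (m n), C (α n i) * homPoly (E n i) n ℂ) →
      (∀ n, 2 * (f n).totalDegree ≤ n) →
      ∃ c : ℕ, ∀ n : ℕ, ∃ (G : Type) (_ : Fintype G) (C : LabelledArithCircuit ℂ (Fin n × Fin n) Unit G),
        C.IsSymmetric (Equiv.Perm (Fin n)) ∧ C.eval (C.output ()) = f n ∧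
          C.orbitSize (Equiv.Perm (Fin n)) ≤ 2 ^ ((Nat.log 2 n + c) ^ c)) ↔
    (∀ f : (n : ℕ) → MvPolynomial (Fin n × Fin n) ℂ, IsVPFamily f →
      (∃ (c : ℕ) (m : ℕ → ℕ) (a b : (n : ℕ) → Fin (m n) → ℕ)
          (E : (n : ℕ) → (i : Fin (m n)) → Multiset (Fin (a n i) × Fin (b n i)))
          (α : (n : ℕ) → Fin (m n) → ℂ),
        (∀ n, m n ≤ (n + 2) ^ c) ∧ (∀ n i, a n i + b n i ≤ c * (n + 1)) ∧
          ∀ n, f n = ∑ i : Fin (m n), C (α n i) * homPoly (E n i) n ℂ) →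
      (∀ n, 2 * (f n).totalDegree ≤ n) →
      ∃ c : ℕ, ∀ n : ℕ, f n ∈ Submodule.span ℂ
        {p : MvPolynomial (Fin n × Fin n) ℂ | ∃ (a b : ℕ) (E : Multiset (Fin a × Fin b)),
          treewidth (SimpleGraph.fromRel fun u v : Fin a ⊕ Fin b =>
              ∃ e ∈ E, u = Sum.inl e.1 ∧ v = Sum.inr e.2) ≤ (Nat.log 2 n + c) ^ c ∧
            p = homPoly E n ℂ}) := by
  constructor
  · intro h f hVP hLV hdeg
    have hsymm : ∀ (n : ℕ) (σ τ : Equiv.Perm (Fin n)),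
        rename (fun ij : Fin n × Fin n => (σ ij.1, τ ij.2)) (f n) = f n := by
      intro n σ τ
      obtain ⟨c, m, a, b, E, α, -, -, hf⟩ := hLV
      rw [hf n]
      exact rename_perm_lvExpansion (a n) (b n) (E n) (α n) σ τ
    obtain ⟨c, hc⟩ := narrowSpan_halfDegree_of_diNarrow f hsymm
      ((OrbitSupport.qpOrbitFamily_iff_diNarrow f).1 (h f hVP hLV hdeg)).2
    exact ⟨c, fun n => hc n (hdeg n)⟩
  · intro h f hVP hLV hdeg
    obtain ⟨c, hc⟩ := h f hVP hLV hdeg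
    refine ⟨c + 2 + 3, fun n => ?_⟩
    rcases Nat.eq_zero_or_pos n with rfl | hn
    · -- `n = 0`: no variables, `f 0` is the constant `coeff 0 (f 0)` (a constant gate, orbit `1`)
      obtain ⟨G, inst, C, hC, hev, horb⟩ :=
        stub_close_orbit 0 0 0 (PatternExpr.const (MvPolynomial.coeff 0 (f 0)))
      refine ⟨G, inst, C, hC, ?_, horb.trans (le_trans (by norm_num) Nat.one_le_two_pow)⟩
      rw [hev, narrowExpansion_close_const]
      exact (MvPolynomial.eq_C_of_isEmpty (f 0)).symm
    · obtain ⟨e, he⟩ := narrowExpression_of_mem_narrowSpan stub_homPoly_close n c hn (f n) (hc n)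
      exact qpOrbit_of_close_eq n (c + 2) (f n) e he

end Summit.ValiantsHypothesis.ValiantsHypothesis.Theorems.OrbitRestorationLinearVolumeQPHalfDegree

end
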